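import Summits.QuantumFields.BalabanUV.T4Continuum.Spine.NE1p.B7AveragingAbelianSectorRemainder
import Literature.MathematicalPhysics.QuantumFieldTheory.Balaban1983to89.B9Eq332FieldAvgCovariance

/-!
# T⁴ programme, spine estimate NE1′ (node O3b/H2) — PURE-GAUGE (FLAT) BACKGROUNDS HAVE NO DIAGONAL CURVATURE: under the background gauge
# transformation `U₀ → U₀^u, A → R(u)A` ([B9] (3.28)) Proposition 4's remainder `C_j(U₀, ·)` is conjugated, so at a PURE-GAUGE background
# `U₀ = 1^u` — ANY invertible gauge function `u`, no smallness on `u` — it vanishes on the gauge-rotated abelian perturbations `R(u)B`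

Cell `pub-balaban-gaps` (YM blitz Y1, track G2), seat `ne1` gen 8 (prover-pub-balaban-gaps-ne1-g8-0); record `HOME/ne/NE1.md` v8 §4 R53.  ADDITIVE —
imports this seat's `B7AveragingAbelianSectorRemainder` (file 2 of gen 8: `C_j(1, B)(c) = 0` and `C_j⁽ⁿ⁾(1, B)(c) = 0` on abelian fields) and the r06
lineage's `Literature/…/B9Eq332FieldAvgCovariance` ([B9] (3.28)∕(3.32) for the gauge-field averages: `logCovIter_rot`, `linCovIter_rot` — the composites
(127) and their linear parts are conjugated under `U₀ → U₀^u, B → R(u)B`, for EVERY background, field and invertible `u`) ONLY; both consumed BY NAME,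
nothing edited or restated; NO new definition.

WHY.  NE1.md v8 R49–R52 make every IDENTITY-level part of R46 (a) kernel at the flat background `U₀ = 1` (and at a jointly commuting background,
R51), and leave «diagonal curvature ∝ NON-FLATNESS of the background» a READING.  At the identity level «∝ non-flatness» means: ZERO whenever the
background is FLAT, i.e. PURE GAUGE, `U₀ = 1^u` (bondwise `u(x)u(x+e_κ)⁻¹`) — for an arbitrary, in general non-commuting, gauge function `u`.
THIS FILE proves exactly that, for Proposition 4's remainder as typed by the lineages: the background's field strength, not its gauge, is what a
diagonal curvature needs.

WHAT THIS FILE PROVES ([folklore] bookkeeping on top of file 2 and [B9] (3.32); 0 sorry).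
* §1 `Ccov_rot` — the one-step remainder (122) is conjugated under (3.28) (r06's `Qcov_rot − linQcov_rot`); `CCovIter_rot` — the REMAINDER (150) `C_j(U₀, B)(c)` is conjugated under (3.28): `C_j(U₀^u, R(u)B)(c) = R(u_j(c₋)) C_j(U₀, B)(c)` for every
  `U₀`, `B`, invertible `u` (r06's `logCovIter_rot − linCovIter_rot`); `CCovIter_rot_smul` (the ray `t ↦ t·R(u)B` is the rotated ray).
* §2 **PURE-GAUGE BACKGROUNDS**: one step, per-bond radius hypotheses only: `C(1^u, R(u)A, c) = 0` (`Ccov_pureGauge_eq_zero`); for an abelian `B` (pairwise commuting values, sup bound `M`, `2(d+1)·Lʲ·M < ln 2`) and ANY invertible gauge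
  function `u`: **`C_j(1^u, R(u)B)(c) = 0`** (`CCovIter_pureGauge_eq_zero`), the remainder is identically `0` along `t ↦ t·R(u)B` near `0`
  (`eventually_CCovIter_pureGauge_smul_eq_zero`), hence **`C_j⁽ⁿ⁾(1^u, R(u)B)(c) = 0` for every `n` and `C_j⁽²⁾(1^u, R(u)B)(c) = 0`**
  (`CCovIterN_pureGauge_eq_zero`) — no diagonal curvature of the composed averaging at a FLAT background, however non-abelian its gauge.
CONSEQUENCE FOR THE ROW (NE1.md v8 R53).  The curvature channel's background dependence (R46 (a) «∝ non-flatness») is confirmed at the identity level: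
what can produce a diagonal curvature is the background's FIELD STRENGTH (its deviation from pure gauge), not the background itself; the quantitative
form (a bound ∝ the plaquette deviation (52)) stays the READING ∕ estimate it was.  Classification UNCHANGED: WORK-bound ∕ OBJECT-bound ∕ NOT idea-bound.

HONEST FRAMING.  [folklore] identities over the lineages' `ℤᵈ` model; nothing of Bałaban's asserted beyond the SHAPE of (127)∕(134)∕(136)∕(150) and
[B9] (3.28)∕(3.32) as typed; no density, R-operation, slot or background of his run constructed; NE1′ NOT proved; spine 0∕9; (B) 0∕13; binders 0∕6; one
fixed finite T⁴ — NOT ℝ⁴, NOT infinite volume, NOT a mass gap, NOT Clay.  0 sorry.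
-/

noncomputable section

open scoped BigOperators Topology
open NormedSpace Finset Filter

namespace Summit.QuantumFields.BalabanUV.T4Continuum.NE1p.B7AveragingAbelianSector

open Literature.MathematicalPhysics.QuantumFieldTheory.Balaban1983to89.B7Prop1Explicit
open Literature.MathematicalPhysics.QuantumFieldTheory.Balaban1983to89.B7Prop3Flat (linQ)
open Literature.MathematicalPhysics.QuantumFieldTheory.Balaban1983to89.B7Prop4GeneralLevels (logCovIter linCovIter)
open Literature.MathematicalPhysics.QuantumFieldTheory.Balaban1983to89.B7Prop5GeneralInduction (CCovIter)
open Literature.MathematicalPhysics.QuantumFieldTheory.Balaban1983to89.B7Eq136SecondOrder (CCovIter2 CCovIter2_def)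
open Literature.MathematicalPhysics.QuantumFieldTheory.Balaban1983to89.B7Eq136Series (CCovIterN CCovIterN_def)
open Literature.MathematicalPhysics.QuantumFieldTheory.Balaban1983to89.B7AvgGaugeCovariance (uLev)
open Literature.MathematicalPhysics.QuantumFieldTheory.Balaban1983to89.B7Eq78Linearization (conjR conjR_apply conjR_sub conjR_smul)
open Literature.MathematicalPhysics.QuantumFieldTheory.Balaban1983to89.B7Prop3GeneralLinear (Qcov linQcov Ccov)
open Literature.MathematicalPhysics.QuantumFieldTheory.Balaban1983to89.B9Eq332FieldAvgCovariance (Qcov_rot linQcov_rot logCovIter_rot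
  linCovIter_rot)

variable {d : ℕ} {𝔸 : Type*} [NormedRing 𝔸] [NormedAlgebra ℂ 𝔸] [CompleteSpace 𝔸] {L : ℕ}

/-! ## §1 The remainders (122) and (150) under the background gauge transformation (3.28) -/

/-- **`C(V₀^u, R(u)A, c) = R(u(c₋)) C(V₀, A, c)`** — the ONE-STEP remainder (122) is conjugated under `V₀ → V₀^u, A → R(u)A`, for every background,
field and invertible gauge function `u` (r06's `Qcov_rot − linQcov_rot`). [cite: Balaban1985BackgroundPropagators, (3.28) p.395, (3.32) p.395; Balaban1985Averaging, (122) p.36] -/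
theorem Ccov_rot (L : ℕ) (u : Site d → 𝔸ˣ) (V₀ : Site d → Fin d → 𝔸ˣ) (A : Site d → Fin d → 𝔸) (q : Site d) (κ : Fin d) :
    Ccov L (gaugeAct u V₀) (fun x κ => conjR (u x) (A x κ)) q κ = conjR (u q) (Ccov L V₀ A q κ) := by
  show Qcov L (gaugeAct u V₀) (fun x κ => conjR (u x) (A x κ)) q κ - linQcov L (gaugeAct u V₀) (fun x κ => conjR (u x) (A x κ)) q κ = _
  rw [Qcov_rot, linQcov_rot, ← conjR_sub]
  rfl


/-- **`C_j(U₀^u, R(u)B)(c) = R(u_j(c₋)) C_j(U₀, B)(c)`** — Proposition 4's remainder is conjugated under `U₀ → U₀^u, B → R(u)B`, for every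
background `U₀`, field `B` and invertible gauge function `u` (`u_j(z) = u(Lʲz)`): the difference of r06's (3.32)-covariances of the composite
(127) and of its linear part. [cite: Balaban1985BackgroundPropagators, (3.28) p.395, (3.32) p.395; Balaban1985Averaging, (150) p.40, (134) p.38] -/
theorem CCovIter_rot (L : ℕ) (u : Site d → 𝔸ˣ) (U₀ : Site d → Fin d → 𝔸ˣ) (B : Site d → Fin d → 𝔸) (j : ℕ) (z : Site d)
    (κ : Fin d) :
    CCovIter L (gaugeAct u U₀) (fun x κ => conjR (u x) (B x κ)) j z κ = conjR (uLev L u j z) (CCovIter L U₀ B j z κ) := by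
  show logCovIter L (gaugeAct u U₀) (fun x κ => conjR (u x) (B x κ)) j z κ
      - linCovIter L (gaugeAct u U₀) (fun x κ => conjR (u x) (B x κ)) j z κ = _
  rw [logCovIter_rot, linCovIter_rot, ← conjR_sub]
  rfl

omit [CompleteSpace 𝔸] in
/-- The ray through a rotated field is the rotated ray: `t·R(u)B = R(u)(tB)`. [folklore] -/
theorem smul_rot (u : Site d → 𝔸ˣ) (B : Site d → Fin d → 𝔸) (t : ℂ) :
    (t • fun x κ => conjR (u x) (B x κ)) = fun x κ => conjR (u x) ((t • B) x κ) := by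
  funext x κ
  simp only [Pi.smul_apply, conjR_smul]

/-- The remainder along the rotated ray: `C_j(U₀^u, t·R(u)B)(c) = R(u_j(c₋)) C_j(U₀, tB)(c)`. [cite: Balaban1985BackgroundPropagators, (3.28)–(3.29) p.395] -/
theorem CCovIter_rot_smul (L : ℕ) (u : Site d → 𝔸ˣ) (U₀ : Site d → Fin d → 𝔸ˣ) (B : Site d → Fin d → 𝔸) (j : ℕ) (z : Site d)
    (κ : Fin d) (t : ℂ) :
    CCovIter L (gaugeAct u U₀) (t • fun x κ => conjR (u x) (B x κ)) j z κ = conjR (uLev L u j z) (CCovIter L U₀ (t • B) j z κ) := by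
  rw [smul_rot, CCovIter_rot]

/-! ## §2 Pure-gauge backgrounds: no diagonal curvature -/

/-- **ONE STEP AT A PURE-GAUGE BACKGROUND: `C(1^u, R(u)A, c) = 0`** for an abelian `A` whose loop sums, tree sums and image at the bond lie inside
the logarithm radius (file 2's per-bond hypotheses — no global sup bound), and ANY invertible gauge function `u`.
[cite: Balaban1985Averaging, (122)–(123) p.36; Balaban1985BackgroundPropagators, (3.32) p.395] -/
theorem Ccov_pureGauge_eq_zero {A : Site d → Fin d → 𝔸} (hA : ∀ x κ y μ, Commute (A x κ) (A y μ)) (hL : 1 ≤ L)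
    (u : Site d → 𝔸ˣ) (q : Site d) (κ : Fin d)
    (hγ : ∀ r : Fin d → Fin L, ‖asum A q (gammaWord L κ (boxVec L r) ++ seg κ (-(L : ℤ)))‖ < Real.log 2)
    (hF₁ : ∀ r : Fin d → Fin L, ‖asum A q (treeWord (boxVec L r))‖ < Real.log 2)
    (hF₂ : ∀ r : Fin d → Fin L, ‖asum A (q + (L : ℤ) • e κ) (treeWord (boxVec L r))‖ < Real.log 2)
    (hQ : ‖linQ L A q κ‖ < Real.log 2) :
    Ccov L (gaugeAct u 1) (fun x κ => conjR (u x) (A x κ)) q κ = 0 := by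
  rw [Ccov_rot, Ccov_one_of_commute hA hL q κ hγ hF₁ hF₂ hQ, conjR_apply, mul_zero, zero_mul]


/-- **`C_j(1^u, R(u)B)(c) = 0` AT A PURE-GAUGE BACKGROUND**: for an abelian field `B` (pairwise commuting values) with sup bound `M` and
`2(d+1)·Lʲ·M < ln 2`, and ANY invertible gauge function `u` (no smallness, not commuting with anything): Proposition 4's remainder at the flat
background `1^u = (u(x)u(x+e_κ)⁻¹)` vanishes on the rotated perturbation `R(u)B` — a diagonal curvature needs FIELD STRENGTH, not gauge.
[cite: Balaban1985Averaging, (134) p.38, (150) p.40; Balaban1985BackgroundPropagators, (3.32) p.395] -/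
theorem CCovIter_pureGauge_eq_zero {B : Site d → Fin d → 𝔸} (hB : ∀ x κ y μ, Commute (B x κ) (B y μ)) (hL : 1 ≤ L) {M : ℝ}
    (hM0 : 0 ≤ M) (hM : ∀ x κ, ‖B x κ‖ ≤ M) (j : ℕ) (hrad : 2 * ((d : ℝ) + 1) * (L : ℝ) ^ j * M < Real.log 2)
    (u : Site d → 𝔸ˣ) (z : Site d) (κ : Fin d) :
    CCovIter L (gaugeAct u 1) (fun x κ => conjR (u x) (B x κ)) j z κ = 0 := by
  rw [CCovIter_rot, CCovIter_one_eq_zero hB hL hM0 hM j hrad, conjR_apply, mul_zero, zero_mul]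

/-- Along the rotated ray the remainder at a pure-gauge background is identically `0` near `t = 0`. [cite: Balaban1985Averaging, (136)–(137) p.39] -/
theorem eventually_CCovIter_pureGauge_smul_eq_zero {B : Site d → Fin d → 𝔸} (hB : ∀ x κ y μ, Commute (B x κ) (B y μ))
    (hL : 1 ≤ L) {M : ℝ} (hM0 : 0 ≤ M) (hM : ∀ x κ, ‖B x κ‖ ≤ M) (j : ℕ) (u : Site d → 𝔸ˣ) (z : Site d) (κ : Fin d) :
    ∀ᶠ t : ℂ in 𝓝 0, CCovIter L (gaugeAct u 1) (t • fun x κ => conjR (u x) (B x κ)) j z κ = 0 :=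
  (eventually_CCovIter_one_smul_eq_zero hB hL hM0 hM j z κ).mono fun t ht => by
    rw [CCovIter_rot_smul, ht, conjR_apply, mul_zero, zero_mul]

/-- **EVERY HOMOGENEOUS TERM OF (136) VANISHES AT A PURE-GAUGE BACKGROUND ON THE ROTATED ABELIAN FIELD**: `C_j⁽ⁿ⁾(1^u, R(u)B)(c) = 0` for all
`n`, and the second-order term `C_j⁽²⁾(1^u, R(u)B)(c) = 0` — no diagonal curvature of the composed averaging at a FLAT background, however
non-abelian its gauge `u`. [cite: Balaban1985Averaging, (136) p.39; Balaban1985BackgroundPropagators, (3.32) p.395] -/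
theorem CCovIterN_pureGauge_eq_zero {B : Site d → Fin d → 𝔸} (hB : ∀ x κ y μ, Commute (B x κ) (B y μ)) (hL : 1 ≤ L) {M : ℝ}
    (hM0 : 0 ≤ M) (hM : ∀ x κ, ‖B x κ‖ ≤ M) (j : ℕ) (u : Site d → 𝔸ˣ) (z : Site d) (κ : Fin d) (n : ℕ) :
    CCovIterN L (gaugeAct u 1) (fun x κ => conjR (u x) (B x κ)) j z κ n = 0 ∧
      CCovIter2 L (gaugeAct u 1) (fun x κ => conjR (u x) (B x κ)) j z κ = 0 := by
  have hev : (fun t : ℂ => CCovIter L (gaugeAct u 1) (t • fun x κ => conjR (u x) (B x κ)) j z κ) =ᶠ[𝓝 0] fun _ => (0 : 𝔸) :=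
    eventually_CCovIter_pureGauge_smul_eq_zero hB hL hM0 hM j u z κ
  refine ⟨?_, ?_⟩
  · rw [CCovIterN_def, hev.iteratedDeriv_eq, iteratedDeriv_const]; simp
  · rw [CCovIter2_def, hev.iteratedDeriv_eq, iteratedDeriv_const]; simp

/-- One-parameter form: at the pure-gauge background `1^u`, the slot `R(u)(s·C) = (s_b·u(b₋)Cu(b₋)⁻¹)_b` — one generator `C` conjugated bond by
bond by a NON-COMMUTING gauge — still has every `C_j⁽ⁿ⁾ = 0`. [cite: Balaban1985Averaging, (136) p.39] -/
theorem CCovIterN_pureGauge_oneParameter_eq_zero (hL : 1 ≤ L) (s : Site d → Fin d → ℂ) (C : 𝔸) {m : ℝ} (hm0 : 0 ≤ m)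
    (hm : ∀ x κ, ‖s x κ‖ ≤ m) (j : ℕ) (u : Site d → 𝔸ˣ) (z : Site d) (κ : Fin d) (n : ℕ) :
    CCovIterN L (gaugeAct u 1) (fun y μ => conjR (u y) (s y μ • C)) j z κ n = 0 :=
  (CCovIterN_pureGauge_eq_zero (B := fun y μ => s y μ • C) (fun x κ y μ => ((Commute.refl C).smul_left _).smul_right _) hL
    (by positivity : 0 ≤ m * ‖C‖) (fun x κ => by rw [norm_smul]; exact mul_le_mul_of_nonneg_right (hm x κ) (norm_nonneg _))
    j u z κ n).1

end Summit.QuantumFields.BalabanUV.T4Continuum.NE1p.B7AveragingAbelianSector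

end
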